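import Literature.NumberTheory.LFunctions.Zhang2022.DetectorRecipeCollapse

/-!
# Zhang (2022), programme F-S3 (cell landau-siegel §E, seat ls-barrier-p6): the shift-detector recipe form is
# PERMUTATION-INVARIANT in the shift triple — `𝔅_{R(b∘σ)} = 𝔅_{R(b)}` for every `σ ∈ S₃`

Y. Zhang, *Discrete mean estimates and the Landau–Siegel zero*, arXiv:2211.02515v1 [Zhang2022LandauSiegel] —
an unrefereed manuscript under adjudication. **WHAT THIS IS NOT: not a claim about Theorems 1–2 of
arXiv:2211.02515, about Landau–Siegel zeros, or about Parity; nothing here asserts any claim of the manuscript.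
The programme SEARCHES and TYPES; no claim about Landau–Siegel zeros, Theorems 1–2 of arXiv:2211.02515 or a
repaired Margin232 until a kernel theorem says so.**

The channel data of `Det.shiftRecipe b` are symmetric functions of the triple seen from channel `j`:
`s_j = e₁ − b_j`, `n_j = e₂ − b_j s_j`, `v_j = n_j − b_j s_j + b_j²` (`shiftS_eq_symE`, `shiftN_eq_symE`,
`shiftVdm_eq_symE`), with `e₁, e₂` the elementary symmetric functions (`Det.symE1/symE2`, invariant under every
permutation of the entries). Hence relabelling the shifts by `σ ∈ S₃` relabels the CHANNELS:
`W_j(b∘σ) = W_{σj}(b)` etc. (`shiftW_comp_perm`), and formula I, its polar form and the diagonal form are unchanged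
(`MformDet_shiftRecipe_comp_perm`, `formDetPolar_shiftRecipe_comp_perm`, `formDet_shiftRecipe_comp_perm`); in
particular `Det.FormDetPSD (shiftRecipe (b ∘ σ)) ↔ Det.FormDetPSD (shiftRecipe b)` (`formDetPSD_shiftRecipe_comp_perm`)
— the cell's convention of SORTED triples (`Det.SignAdmissible`: `b₀ < b₁ < b₂`) loses nothing (cell memo
barrier/num/SHIFT-PSD.md §0: «FormDet(shiftRecipe b) is permutation-invariant in b, so sorting loses nothing» — here a
theorem), and theorems stated for one ordering (e.g. the edge null profile of `DetectorShiftEdgeKernel` at `(t; k, k+1)`)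
transfer to every ordering. Elementary; standard axioms; no definitions.

References: Y. Zhang, arXiv:2211.02515v1 (2022), Prop. 7.1 p. 44 with (7.19)–(7.21), §8 (8.11)–(8.18).
[cite: Zhang2022LandauSiegel, Prop 7.1 p. 44, (8.11)–(8.12)]
-/

noncomputable section

open Complex Real ComplexConjugate

namespace Literature.NumberTheory.LFunctions.Zhang2022

namespace Det

variable (b : Fin 3 → ℝ) (σ : Equiv.Perm (Fin 3))

/-! ### The channel data as symmetric functions seen from channel `j` -/

/-- `s_j = e₁ − b_j`. [cite: Zhang2022LandauSiegel, §8 (8.13)–(8.18)] -/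
theorem shiftS_eq_symE (j : Fin 3) : shiftS b j = symE1 b - b j := by
  fin_cases j <;> simp [shiftS, symE1] <;> ring

/-- `n_j = e₂ − b_j(e₁ − b_j)`. [cite: Zhang2022LandauSiegel, §8 (8.13)–(8.18)] -/
theorem shiftN_eq_symE (j : Fin 3) : shiftN b j = symE2 b - b j * (symE1 b - b j) := by
  fin_cases j <;> simp [shiftN, symE1, symE2] <;> ring

/-- `v_j = Π_{i≠j}(b_i − b_j) = n_j − b_j s_j + b_j²`. [cite: Zhang2022LandauSiegel, proof of Prop 7.1, (7.19)–(7.20)] -/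
theorem shiftVdm_eq_symE (j : Fin 3) :
    shiftVdm b j = symE2 b - b j * (symE1 b - b j) - b j * (symE1 b - b j) + (b j) ^ 2 := by
  fin_cases j <;> simp [shiftVdm, symE1, symE2] <;> ring

/-- `e₁ = Σ_i b_i`. [cite: Zhang2022LandauSiegel, §8 (8.13)–(8.18)] -/
theorem symE1_eq_sum : symE1 b = ∑ i : Fin 3, b i := by
  simp [symE1, Fin.sum_univ_three]

/-- `2e₂ = (Σ_i b_i)² − Σ_i b_i²`. [cite: Zhang2022LandauSiegel, §8 (8.13)–(8.18)] -/
theorem two_mul_symE2_eq_sum : 2 * symE2 b = (∑ i : Fin 3, b i) ^ 2 - ∑ i : Fin 3, (b i) ^ 2 := by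
  simp [symE2, Fin.sum_univ_three]
  ring

/-- `e₁(b∘σ) = e₁(b)`. [cite: Zhang2022LandauSiegel, §8 (8.13)–(8.18)] -/
theorem symE1_comp_perm : symE1 (b ∘ σ) = symE1 b := by
  rw [symE1_eq_sum, symE1_eq_sum]
  exact Equiv.sum_comp σ b

/-- `e₂(b∘σ) = e₂(b)`. [cite: Zhang2022LandauSiegel, §8 (8.13)–(8.18)] -/
theorem symE2_comp_perm : symE2 (b ∘ σ) = symE2 b := by
  have h1 := two_mul_symE2_eq_sum (b ∘ σ)
  have h2 := two_mul_symE2_eq_sum b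
  have e1 : (∑ i : Fin 3, (b ∘ σ) i) = ∑ i : Fin 3, b i := Equiv.sum_comp σ b
  have e2 : (∑ i : Fin 3, ((b ∘ σ) i) ^ 2) = ∑ i : Fin 3, (b i) ^ 2 := Equiv.sum_comp σ (fun i => (b i) ^ 2)
  rw [e1, e2] at h1
  linarith

/-! ### Relabelling the shifts relabels the channels -/

/-- `s_j(b∘σ) = s_{σj}(b)`. [cite: Zhang2022LandauSiegel, §8 (8.13)–(8.18)] -/
theorem shiftS_comp_perm (j : Fin 3) : shiftS (b ∘ σ) j = shiftS b (σ j) := by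
  rw [shiftS_eq_symE, shiftS_eq_symE, symE1_comp_perm]
  rfl

/-- `n_j(b∘σ) = n_{σj}(b)`. [cite: Zhang2022LandauSiegel, §8 (8.13)–(8.18)] -/
theorem shiftN_comp_perm (j : Fin 3) : shiftN (b ∘ σ) j = shiftN b (σ j) := by
  rw [shiftN_eq_symE, shiftN_eq_symE, symE1_comp_perm, symE2_comp_perm]
  rfl

/-- `v_j(b∘σ) = v_{σj}(b)`. [cite: Zhang2022LandauSiegel, proof of Prop 7.1, (7.19)–(7.20)] -/
theorem shiftVdm_comp_perm (j : Fin 3) : shiftVdm (b ∘ σ) j = shiftVdm b (σ j) := by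
  rw [shiftVdm_eq_symE, shiftVdm_eq_symE, symE1_comp_perm, symE2_comp_perm]
  rfl

/-- `W_j(b∘σ) = W_{σj}(b)`. [cite: Zhang2022LandauSiegel, proof of Prop 7.1, (7.19)–(7.21)] -/
theorem shiftW_comp_perm (j : Fin 3) : shiftW (b ∘ σ) j = shiftW b (σ j) := by
  unfold shiftW
  rw [shiftS_comp_perm, shiftVdm_comp_perm]
  rfl

/-! ### Formula I, the polar form and the diagonal form are permutation-invariant -/

/-- **`M_{R(b∘σ)} = M_{R(b)}`** (any profiles). [cite: Zhang2022LandauSiegel, Prop 7.1 p. 44, (8.11)–(8.12)] -/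
theorem MformDet_shiftRecipe_comp_perm (g g' h h' : ℝ → ℂ) :
    MformDet (shiftRecipe (b ∘ σ)) g g' h h' = MformDet (shiftRecipe b) g g' h h' := by
  unfold MformDet
  congr 1
  simp only [shiftRecipe]
  rw [← Equiv.sum_comp σ (fun j => shiftW b j *
      ∫ y in (0:ℝ)..1, dipoleIntegrandDet (b j) (shiftS b j) (shiftN b j) g g' h h' y)]
  refine Finset.sum_congr rfl fun j _ => ?_
  rw [shiftW_comp_perm, shiftS_comp_perm, shiftN_comp_perm]
  rfl

/-- **`P_{R(b∘σ)} = P_{R(b)}`.** [cite: Zhang2022LandauSiegel, Prop 7.1 p. 44, (8.11)–(8.12)] -/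
theorem formDetPolar_shiftRecipe_comp_perm (g g' h h' : ℝ → ℂ) :
    FormDetPolar (shiftRecipe (b ∘ σ)) g g' h h' = FormDetPolar (shiftRecipe b) g g' h h' := by
  rw [FormDetPolar, FormDetPolar, MformDet_shiftRecipe_comp_perm, MformDet_shiftRecipe_comp_perm]

/-- **`𝔅_{R(b∘σ)} = 𝔅_{R(b)}`.** [cite: Zhang2022LandauSiegel, Prop 7.1 p. 44, (8.11)–(8.12)] -/
theorem formDet_shiftRecipe_comp_perm (g g' : ℝ → ℂ) :
    FormDet (shiftRecipe (b ∘ σ)) g g' = FormDet (shiftRecipe b) g g' := by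
  rw [FormDet, FormDet, formDetPolar_shiftRecipe_comp_perm]

/-- **The E-010 slot is permutation-invariant:** `FormDetPSD (shiftRecipe (b∘σ)) ↔ FormDetPSD (shiftRecipe b)` —
sorting the triple (the convention of `Det.SignAdmissible`) loses nothing.
[cite: Zhang2022LandauSiegel, Prop 7.1 p. 44, (7.2), (8.11)–(8.12)] -/
theorem formDetPSD_shiftRecipe_comp_perm :
    FormDetPSD (shiftRecipe (b ∘ σ)) ↔ FormDetPSD (shiftRecipe b) := by
  simp only [FormDetPSD, formDet_shiftRecipe_comp_perm]

/-- Concrete reorderings as `Fin 3 → ℝ` literals: `(b₁, b₀, b₂)` (swap of the first two shifts).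
[cite: Zhang2022LandauSiegel, Prop 7.1 p. 44, (8.11)–(8.12)] -/
theorem formDet_shiftRecipe_swap01 (x y z : ℝ) (g g' : ℝ → ℂ) :
    FormDet (shiftRecipe ![y, x, z]) g g' = FormDet (shiftRecipe ![x, y, z]) g g' := by
  have h : (![y, x, z] : Fin 3 → ℝ) = (![x, y, z] : Fin 3 → ℝ) ∘ (Equiv.swap (0 : Fin 3) 1) := by
    funext j
    fin_cases j <;> simp [Equiv.swap_apply_of_ne_of_ne]
  rw [h, formDet_shiftRecipe_comp_perm]

/-- … and `(x, z, y)` (swap of the last two shifts). [cite: Zhang2022LandauSiegel, Prop 7.1 p. 44, (8.11)–(8.12)] -/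
theorem formDet_shiftRecipe_swap12 (x y z : ℝ) (g g' : ℝ → ℂ) :
    FormDet (shiftRecipe ![x, z, y]) g g' = FormDet (shiftRecipe ![x, y, z]) g g' := by
  have h : (![x, z, y] : Fin 3 → ℝ) = (![x, y, z] : Fin 3 → ℝ) ∘ (Equiv.swap (1 : Fin 3) 2) := by
    funext j
    fin_cases j <;> simp [Equiv.swap_apply_of_ne_of_ne]
  rw [h, formDet_shiftRecipe_comp_perm]

/-- … and the cyclic shift `(z, x, y)`. [cite: Zhang2022LandauSiegel, Prop 7.1 p. 44, (8.11)–(8.12)] -/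
theorem formDet_shiftRecipe_cycle (x y z : ℝ) (g g' : ℝ → ℂ) :
    FormDet (shiftRecipe ![z, x, y]) g g' = FormDet (shiftRecipe ![x, y, z]) g g' := by
  rw [formDet_shiftRecipe_swap01 x z y, formDet_shiftRecipe_swap12 x y z]

end Det

end Literature.NumberTheory.LFunctions.Zhang2022
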